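import Summits.QuantumFields.YangMills.Theorems.BalabanUVNodesN15TwoSpacingGluingNeumannDefectClosed
import HarnessLib

/-!
# THE GLUING STEP AT TWO LATTICE SPACINGS, XLIX: ENTRY 0 AND THE REMAINDER OF THE COVER's PARAMETRIX ON THE DOUBLED TORUS — THE FIVE `G₀`∕`R` ROWS OF FILE 50's BUNDLE WITH
# NO DISPLAYED ROW (dag-n15-c g13, FILE 91; N15 = NE2, s1 «background-layer OPERATOR ingredient»)

Cell `pub-ymgap`, seat `pub-ymgap-dag-n15-c` (R134 (a); HUMAN RULING D-0062), generation 13.  `bears_on: R4∕N15 · K3⁷ SpineGivenEndpointR13SepCoPH (stmt-QuantumFields-20544)`.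
Filed `--supports stmt-QuantumFields-20544 --as helper` — COUNT-NEUTRAL.  Theorems only (0 `def`, 0 `sorry`).  Imports BY NAME FILE 80 (through it FILES 45, 57, 63, 66–79 and dag-n15-a's
PROGRAMME N); nothing in the tree is modified.

WHAT.  Doubled torus `M = MP (paramsOf d L (m+1) k hL)`, FILE 70's cover (`knitH`, `knitG`), parametrix `G₀ = Σ M_hG(□)M_h` and remainder `R = −Σ[Δ_a, M_h]G(□)M_h` at the coarse spacing
`L^{−k}` and the fine spacing `L^{−(k+r)}`, King's pairing: ★★★ **`knit_entryZero_rows`** — `∃ δ A m₀ r₀ > 0, κ ≥ 0 ∀ m k r (k ≥ 1, 4 ≤ L^k)`: `G₀′ ≤ Ae^{−δd}`, `R ≤ (κ∕L^m)e^{−δd}`,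
`R′ ≤ (κ∕L^m)e^{−δd}`, `𝔇(G₀′, G₀) ≤ m₀(L^k)^{−1∕16}e^{−δd}`, `𝔇(R′, R) ≤ r₀(L^k)^{−1∕16}e^{−δd}` — FILE 45 `hasMaj_parametrix` ∕ `hasMaj_idef_parametrix` after FILE 63 `parametrix_cut`,
FILE 57 `hasMaj_remainder_in` ∕ `hasMaj_idef_remainder_in`, with the rows of FILE 78's proof (N-IIIb cut rows, FILE 69 remainder rows `κ₀∕L^m`, N-IIc cut defect, FILE 80's CLOSED
remainder defect `hasMaj_idef_commOp_deltaOp_comp_knitG_closed`, FILE 67 fit, FILE 66 overlap).  NO smallness guard is needed for these five rows (it enters only FILE 50's socket).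
The entry-0 and `R` rows of FILE 50's `GluedLetters` for the glued `U ≡ 1` family; with FILES 84–90 (entries 1–3) only the three adjoint-remainder rows `R̃`, `R̃′`, `𝔇(R̃′,R̃)` remain
(dag-n15-a N-IIn; `(c)⁺` conditional on the located source-Hölder letter `hSrc`).

HONEST FRAMING ∕ LIMITS.  Block-majorant bookkeeping over LANDED rows at `U ≡ 1` on the doubled-cube torus MODEL (cube = half torus: circular as an estimate); no new analytic
estimate; nothing of [B5]∕[B6]∕[B9] asserted.  NE2⁺ NOT PRINTED, NOT proved; N15 NOT discharged; counts of record UNMOVED (typed 28∕28 · discharged 5∕27); one finite 𝕋⁴ at fixed ε per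
index — NOT infinite volume, NOT OS on ℝ⁴, NOT a mass gap, NOT Clay; R4 closes `BalabanLadder.UV` only.  Restate-immune (no Theses import).
-/

noncomputable section

namespace Summit.QuantumFields.YangMills.BalabanUVNodes.N15.Gluing

open Real
open Literature.MathematicalPhysics.QuantumFieldTheory.Balaban1983to89
open Literature.MathematicalPhysics.QuantumFieldTheory.Balaban1983to89.B5Prop11Plancherel (Tor fine)
open Literature.MathematicalPhysics.QuantumFieldTheory.Balaban1983to89.B11SectG (BlockNorm HasMaj RowSum)
open Literature.MathematicalPhysics.QuantumFieldTheory.Balaban1983to89.T4EtaRateDefect (idef)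
open Literature.MathematicalPhysics.QuantumFieldTheory.Balaban1983to89.T4EtaRateCoeffDefect (pull)
open Literature.MathematicalPhysics.QuantumFieldTheory.Balaban1983to89.B6Prop26Gluing (mulOp ind ind_nonneg ind_le_one)
open Literature.MathematicalPhysics.QuantumFieldTheory.Balaban1983to89.B6UnitTorusCarrier (unitTorusGeo triangle254_unitTorusGeo rowSum_unitTorusGeo unitTorusGeo_dist_nonneg
  unitTorusGeo_dist_self)
open Literature.MathematicalPhysics.QuantumFieldTheory.Balaban1983to89.B5SiteBridgeP12 (MP)
open Literature.MathematicalPhysics.QuantumFieldTheory.King1986.Torus (blockOf tdistT tdistT_nonneg)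
open Summit.QuantumFields.YangMills.BalabanUVNodes.N15.VectorPiece (bshiftEquiv kingPrV blkFine)
open Summit.QuantumFields.YangMills.BalabanUVNodes.N15.TwoGrid (paramsOf deltaOp gOp neumannCubeG chiCube cubeBlocks landauRe qvRe qvAdjRe ineq110_114_pair hasMaj_gOp_of_ineq
  hasMaj_grad_of_ineq hasMaj_landauRe hasMaj_chiCube_symOp_comp hasMaj_comp_mulOp_chiInt hasMaj_idef_chiCube_neumannCubeG)

variable {d : ℕ}

section Rows

variable {L : ℕ} [NeZero L]

/-- ★★★ **ENTRY 0 AND THE REMAINDER OF THE COVER's PARAMETRIX ON THE DOUBLED TORUS, BOTH SPACINGS, NO DISPLAYED ROW**: for odd `L ≥ 3`, `a > 0` there are `δ, A, m₀, r₀ > 0`, `κ ≥ 0` with, for all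
`m, k ≥ 1, r` with `4 ≤ L^k`: `G₀′ ≤ Ae^{−δd}`, `R ≤ (κ∕L^m)e^{−δd}`, `R′ ≤ (κ∕L^m)e^{−δd}`, `𝔇(G₀′, G₀) ≤ m₀(L^k)^{−1∕16}e^{−δd}`, `𝔇(R′, R) ≤ r₀(L^k)^{−1∕16}e^{−δd}`.
[cite: Balaban1984PropagatorsII, (2.36)–(2.37) p.229, (2.91)–(2.93) p.239, (2.133)–(2.136) p.247 (mechanism); Balaban1985BackgroundPropagators, Thm 3.14 pp.426–427 (difference template);
Balaban1984PropagatorsI, Prop. 1.2 (1.110) p.35, (1.126) p.38] -/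
theorem knit_entryZero_rows (hL : Odd L ∧ 1 < L) {a : ℝ} (ha : 0 < a) :
    ∃ δ A κ m₀ r₀ : ℝ, 0 < δ ∧ 0 < A ∧ 0 ≤ κ ∧ 0 < m₀ ∧ 0 < r₀ ∧ ∀ (m kk r : ℕ) (_hk : 1 ≤ kk) (_hn4 : 4 ≤ L ^ kk),
      HasMaj (BlockNorm.ofBlocks (unitTorusGeo L kk (MP (paramsOf d L (m + 1) kk hL)))
          (fun i : Tor (fine (L ^ r * L ^ kk) (MP (paramsOf d L (m + 1) kk hL))) × Fin (d + 1) => blockOf (L ^ r * L ^ kk) (MP (paramsOf d L (m + 1) kk hL)) i.1))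
        (BlockNorm.ofBlocks (unitTorusGeo L kk (MP (paramsOf d L (m + 1) kk hL)))
          (fun i : Tor (fine (L ^ r * L ^ kk) (MP (paramsOf d L (m + 1) kk hL))) × Fin (d + 1) => blockOf (L ^ r * L ^ kk) (MP (paramsOf d L (m + 1) kk hL)) i.1))
        (parametrix (knitH d L m kk (L ^ r * L ^ kk) hL) (knitG d L m kk (L ^ r * L ^ kk) hL a))
        (fun y y' => A * Real.exp (-(δ * tdistT (MP (paramsOf d L (m + 1) kk hL)) y y'))) ∧
      HasMaj (BlockNorm.ofBlocks (unitTorusGeo L kk (MP (paramsOf d L (m + 1) kk hL)))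
          (fun b : Tor (fine (L ^ kk) (MP (paramsOf d L (m + 1) kk hL))) × Fin (d + 1) => blockOf (L ^ kk) (MP (paramsOf d L (m + 1) kk hL)) b.1))
        (BlockNorm.ofBlocks (unitTorusGeo L kk (MP (paramsOf d L (m + 1) kk hL)))
          (fun b : Tor (fine (L ^ kk) (MP (paramsOf d L (m + 1) kk hL))) × Fin (d + 1) => blockOf (L ^ kk) (MP (paramsOf d L (m + 1) kk hL)) b.1))
        (remainder (deltaOp (MP (paramsOf d L (m + 1) kk hL)) (L ^ kk) a) (knitH d L m kk (L ^ kk) hL) (knitG d L m kk (L ^ kk) hL a))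
        (fun y y' => κ / ((L ^ m : ℕ) : ℝ) * Real.exp (-(δ * tdistT (MP (paramsOf d L (m + 1) kk hL)) y y'))) ∧
      HasMaj (BlockNorm.ofBlocks (unitTorusGeo L kk (MP (paramsOf d L (m + 1) kk hL)))
          (fun i : Tor (fine (L ^ r * L ^ kk) (MP (paramsOf d L (m + 1) kk hL))) × Fin (d + 1) => blockOf (L ^ r * L ^ kk) (MP (paramsOf d L (m + 1) kk hL)) i.1))
        (BlockNorm.ofBlocks (unitTorusGeo L kk (MP (paramsOf d L (m + 1) kk hL)))
          (fun i : Tor (fine (L ^ r * L ^ kk) (MP (paramsOf d L (m + 1) kk hL))) × Fin (d + 1) => blockOf (L ^ r * L ^ kk) (MP (paramsOf d L (m + 1) kk hL)) i.1))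
        (remainder (deltaOp (MP (paramsOf d L (m + 1) kk hL)) (L ^ r * L ^ kk) a) (knitH d L m kk (L ^ r * L ^ kk) hL) (knitG d L m kk (L ^ r * L ^ kk) hL a))
        (fun y y' => κ / ((L ^ m : ℕ) : ℝ) * Real.exp (-(δ * tdistT (MP (paramsOf d L (m + 1) kk hL)) y y'))) ∧
      HasMaj (BlockNorm.ofBlocks (unitTorusGeo L kk (MP (paramsOf d L (m + 1) kk hL)))
          (fun b : Tor (fine (L ^ kk) (MP (paramsOf d L (m + 1) kk hL))) × Fin (d + 1) => blockOf (L ^ kk) (MP (paramsOf d L (m + 1) kk hL)) b.1))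
        (BlockNorm.ofBlocks (unitTorusGeo L kk (MP (paramsOf d L (m + 1) kk hL)))
          (fun i : Tor (fine (L ^ r * L ^ kk) (MP (paramsOf d L (m + 1) kk hL))) × Fin (d + 1) => blockOf (L ^ r * L ^ kk) (MP (paramsOf d L (m + 1) kk hL)) i.1))
        (idef (pull (kingPrV L kk r (MP (paramsOf d L (m + 1) kk hL)))) (pull (kingPrV L kk r (MP (paramsOf d L (m + 1) kk hL))))
          (parametrix (knitH d L m kk (L ^ r * L ^ kk) hL) (knitG d L m kk (L ^ r * L ^ kk) hL a)) (parametrix (knitH d L m kk (L ^ kk) hL) (knitG d L m kk (L ^ kk) hL a)))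
        (fun y y' => m₀ * ((L ^ kk : ℕ) : ℝ) ^ (-(1 / 16 : ℝ)) * Real.exp (-(δ * tdistT (MP (paramsOf d L (m + 1) kk hL)) y y'))) ∧
      HasMaj (BlockNorm.ofBlocks (unitTorusGeo L kk (MP (paramsOf d L (m + 1) kk hL)))
          (fun b : Tor (fine (L ^ kk) (MP (paramsOf d L (m + 1) kk hL))) × Fin (d + 1) => blockOf (L ^ kk) (MP (paramsOf d L (m + 1) kk hL)) b.1))
        (BlockNorm.ofBlocks (unitTorusGeo L kk (MP (paramsOf d L (m + 1) kk hL)))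
          (fun i : Tor (fine (L ^ r * L ^ kk) (MP (paramsOf d L (m + 1) kk hL))) × Fin (d + 1) => blockOf (L ^ r * L ^ kk) (MP (paramsOf d L (m + 1) kk hL)) i.1))
        (idef (pull (kingPrV L kk r (MP (paramsOf d L (m + 1) kk hL)))) (pull (kingPrV L kk r (MP (paramsOf d L (m + 1) kk hL))))
          (remainder (deltaOp (MP (paramsOf d L (m + 1) kk hL)) (L ^ r * L ^ kk) a) (knitH d L m kk (L ^ r * L ^ kk) hL) (knitG d L m kk (L ^ r * L ^ kk) hL a))
          (remainder (deltaOp (MP (paramsOf d L (m + 1) kk hL)) (L ^ kk) a) (knitH d L m kk (L ^ kk) hL) (knitG d L m kk (L ^ kk) hL a)))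
        (fun y y' => r₀ * ((L ^ kk : ℕ) : ℝ) ^ (-(1 / 16 : ℝ)) * Real.exp (-(δ * tdistT (MP (paramsOf d L (m + 1) kk hL)) y y'))) := by
  have hL3 : 3 ≤ L := by obtain ⟨⟨j, hj⟩, h1⟩ := hL; omega
  have hLpos : 0 < L := by omega
  have hLodd : Odd L := hL.1
  have hL2 : 2 ≤ L := hL.2
  obtain ⟨δ₀, C, Cα, Cε, Cαε, hδ₀, hC, H⟩ := ineq110_114_pair (d := d) hL ha
  obtain ⟨δ₁, C₁, hδ₁, hC₁, HL⟩ := hasMaj_landauRe (d := d) (L := L)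
  obtain ⟨δc, mc, hδc, hmc, HC⟩ := hasMaj_idef_chiCube_neumannCubeG (d := d) hLodd hL2 ha (γ := 1 / 8) (by norm_num) (by norm_num)
  obtain ⟨δ7, Cr, hδ7, hCr, H7⟩ := hasMaj_idef_commOp_deltaOp_comp_knitG_closed (d := d) hL ha
  have hδK : 0 < min δ₀ δ₁ := lt_min hδ₀ hδ₁
  set crK : ℝ := B4Sect5Proof.latticeConst (d + 1) (min δ₀ δ₁ / 4) with hcrK_def
  have hcrK : 0 ≤ crK := B4Sect5Proof.latticeConst_nonneg (d + 1) (by positivity)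
  set κ₀ : ℝ := ((d + 1 : ℕ) * (32 * π ^ 2 * (2 ^ (d + 1) * (C * Real.exp δ₀)) + 2 * (π * (2 ^ (d + 1) * (C * Real.exp δ₀ * Real.exp δ₀)))) +
    2 ^ (d + 1) * ((π * (d + 1) * (Real.exp 1 * (min δ₀ δ₁ / 4))⁻¹ + 2 * (π * (d + 1))) * (|a| * (Real.exp (min δ₀ δ₁) * Real.exp (min δ₀ δ₁)) + C₁) * (C * Real.exp δ₀) * crK) +
    (|a| * (Real.exp (min δ₀ δ₁) * Real.exp (min δ₀ δ₁)) + C₁) * (8 / min δ₀ δ₁) * (2 ^ (d + 1) * (C * Real.exp δ₀)) * crK) with hκ₀_def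
  have hκ₀ : 0 ≤ κ₀ := by positivity
  set δ : ℝ := min (min δ₀ δ₁ / 2) (min δc δ7) with hδ_def
  have hδ : 0 < δ := lt_min (by positivity) (lt_min hδc hδ7)
  have hδK2 : δ ≤ min δ₀ δ₁ / 2 := min_le_left _ _
  have hδ0' : δ ≤ δ₀ := hδK2.trans (by linarith [min_le_left δ₀ δ₁])
  have hδc' : δ ≤ δc := (min_le_right _ _).trans (min_le_left _ _)
  have hδ7' : δ ≤ δ7 := (min_le_right _ _).trans (min_le_right _ _)
  set cr : ℝ := B4Sect5Proof.latticeConst (d + 1) (δ / 4) with hcr_def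
  have hcr : 0 ≤ cr := B4Sect5Proof.latticeConst_nonneg (d + 1) (by positivity)
  set Nov : ℝ := (((2 * L) ^ (d + 1) : ℕ) : ℝ) with hNov_def
  set β : ℝ := 2 ^ (d + 1) * (C * Real.exp δ₀) with hβ_def
  have hβ : 0 ≤ β := by positivity
  refine ⟨δ, Nov * β + 1, Nov * κ₀, Nov * (2 * β * (π * (d + 1)) + mc) + 1, Nov * (κ₀ * (π * (d + 1)) + Cr) + 1, hδ, by positivity, by positivity, by positivity, by positivity,
    fun m kk r hk hn4 => ?_⟩
  -- the index's data
  set M : Fin (d + 1) → ℕ := MP (paramsOf d L (m + 1) kk hL) with hMdef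
  have hM : ∀ ν, M ν = 2 * L * L ^ m := MP_succ_eq L m kk hL
  have hM' : ∀ ν, M ν = 2 * (L * L ^ m) := fun ν => by rw [hM ν, mul_assoc]
  have hw : 0 < L ^ m := pow_pos hLpos m
  have hn : 1 ≤ L ^ kk := Nat.one_le_pow _ _ hLpos
  have hn' : 1 ≤ L ^ r * L ^ kk := Nat.one_le_iff_ne_zero.mpr (Nat.mul_ne_zero (pow_ne_zero r (NeZero.ne L)) (pow_ne_zero kk (NeZero.ne L)))
  have hfit := coverMargin_fit hL3 m
  have hfit1 : coverMargin L m + 2 * L ^ m + 1 ≤ L * L ^ m := by omega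
  have hS : L * L ^ m ≤ 2 * L * L ^ m := by rw [mul_assoc]; omega
  have hSe : L ^ (m + 1) = L * L ^ m := by rw [pow_succ, mul_comm]
  have hexp16 : (-((1 : ℝ) / 8 / 2)) = -(1 / 16 : ℝ) := by norm_num
  have hwR : (1 : ℝ) ≤ ((L ^ m : ℕ) : ℝ) := by exact_mod_cast hw
  have hwpos : (0 : ℝ) < ((L ^ m : ℕ) : ℝ) := by linarith
  have hnR : (1 : ℝ) ≤ ((L ^ kk : ℕ) : ℝ) := by exact_mod_cast hn
  have hwm : ((L ^ m : ℕ) : ℝ) ≤ 2 * ((coverMargin L m : ℝ) + 1) := by exact_mod_cast le_two_mul_coverMargin hL3 m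
  set ε : ℝ := ((L ^ kk : ℕ) : ℝ) ^ (-(1 / 16 : ℝ)) with hε_def
  obtain ⟨-, hnwε, -, hε0⟩ := rpow_sixteenth_facts hnR hwR
  have hrow := rowSum_unitTorusGeo (L := L) (k := kk) (M := M) (σ := δ / 4) (by positivity)
  have hblk : (fun i : Tor (fine (L ^ r * L ^ kk) M) × Fin (d + 1) => blockOf (L ^ r * L ^ kk) M i.1) =
      (fun b : Tor (fine (L ^ kk) M) × Fin (d + 1) => blockOf (L ^ kk) M b.1) ∘ kingPrV L kk r M := (VectorPiece.blkFine_comp_kingPrV (M := M) L kk r).symm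
  have hind : ∀ (k : Fin (d + 1) → ZMod (2 * L)) (y y' : Tor M),
      0 ≤ ind (g := unitTorusGeo L kk M) ((cubeBlocks M (coverCorner M (L ^ m) L (coverMargin L m) k) (L * L ^ m) : Finset (Tor M)) : Set (Tor M)) y *
        ind (g := unitTorusGeo L kk M) ((cubeBlocks M (coverCorner M (L ^ m) L (coverMargin L m) k) (L * L ^ m) : Finset (Tor M)) : Set (Tor M)) y' :=
    fun k y y' => mul_nonneg (ind_nonneg _ _) (ind_nonneg _ _)
  have hind1 : ∀ (k : Fin (d + 1) → ZMod (2 * L)) (y y' : Tor M),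
      0 ≤ ind (g := unitTorusGeo L kk M) ((cubeBlocks M (coverCorner M (L ^ m) L (coverMargin L m) k) (L * L ^ m) : Finset (Tor M)) : Set (Tor M)) y' :=
    fun k y y' => ind_nonneg _ _
  -- torus letters at both spacings
  have Hk := (H (m + 1) kk r hk).1
  have Hk' := (H (m + 1) kk r hk).2
  have hG := hasMaj_gOp_of_ineq (L := L) (k := kk) M (L ^ kk) a hn Hk hC.le
  have hD := fun ν => hasMaj_grad_of_ineq (L := L) (k := kk) M (L ^ kk) a hn Hk hC.le ν
  have hG' := hasMaj_gOp_of_ineq (L := L) (k := kk) M (L ^ r * L ^ kk) a hn' Hk' hC.le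
  have hD' := fun ν => hasMaj_grad_of_ineq (L := L) (k := kk) M (L ^ r * L ^ kk) a hn' Hk' hC.le ν
  have hNL := HL kk (L ^ kk) M
  have hNL' := HL kk (L ^ r * L ^ kk) M
  -- the cut rows at both spacings (rate weakened to `δ`)
  have hGc : ∀ k : Fin (d + 1) → ZMod (2 * L),
      HasMaj (BlockNorm.ofBlocks (unitTorusGeo L kk M) (fun b : Tor (fine (L ^ kk) M) × Fin (d + 1) => blockOf (L ^ kk) M b.1))
        (BlockNorm.ofBlocks (unitTorusGeo L kk M) (fun b : Tor (fine (L ^ kk) M) × Fin (d + 1) => blockOf (L ^ kk) M b.1))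
        (mulOp (chiCube M (L ^ kk) (coverCorner M (L ^ m) L (coverMargin L m) k) (L * L ^ m)) ∘ₗ knitG d L m kk (L ^ kk) hL a k)
        (fun y y' => ind ((cubeBlocks M (coverCorner M (L ^ m) L (coverMargin L m) k) (L * L ^ m) : Finset (Tor M)) : Set (Tor M)) y *
          ind ((cubeBlocks M (coverCorner M (L ^ m) L (coverMargin L m) k) (L * L ^ m) : Finset (Tor M)) : Set (Tor M)) y' * (β * Real.exp (-(δ * tdistT M y y')))) := fun k =>
    hasMaj_rate_le (hind k) hβ hδ0'
      (hasMaj_chiCube_symOp_comp (L := L) (k := kk) (c := coverCorner M (L ^ m) L (coverMargin L m) k) (S := L * L ^ m) hC.le hδ₀.le hM'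
        (hasMaj_comp_mulOp_chiInt (c := coverCorner M (L ^ m) L (coverMargin L m) k) (S := L * L ^ m) hC.le hG))
  have hGc' : ∀ k : Fin (d + 1) → ZMod (2 * L),
      HasMaj (BlockNorm.ofBlocks (unitTorusGeo L kk M) ((fun b : Tor (fine (L ^ kk) M) × Fin (d + 1) => blockOf (L ^ kk) M b.1) ∘ kingPrV L kk r M))
        (BlockNorm.ofBlocks (unitTorusGeo L kk M) ((fun b : Tor (fine (L ^ kk) M) × Fin (d + 1) => blockOf (L ^ kk) M b.1) ∘ kingPrV L kk r M))
        (mulOp (chiCube M (L ^ r * L ^ kk) (coverCorner M (L ^ m) L (coverMargin L m) k) (L * L ^ m)) ∘ₗ knitG d L m kk (L ^ r * L ^ kk) hL a k)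
        (fun y y' => ind ((cubeBlocks M (coverCorner M (L ^ m) L (coverMargin L m) k) (L * L ^ m) : Finset (Tor M)) : Set (Tor M)) y *
          ind ((cubeBlocks M (coverCorner M (L ^ m) L (coverMargin L m) k) (L * L ^ m) : Finset (Tor M)) : Set (Tor M)) y' * (β * Real.exp (-(δ * tdistT M y y')))) := fun k => by
    rw [← hblk]
    exact hasMaj_rate_le (hind k) hβ hδ0'
      (hasMaj_chiCube_symOp_comp (L := L) (k := kk) (c := coverCorner M (L ^ m) L (coverMargin L m) k) (S := L * L ^ m) hC.le hδ₀.le hM'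
        (hasMaj_comp_mulOp_chiInt (c := coverCorner M (L ^ m) L (coverMargin L m) k) (S := L * L ^ m) hC.le hG'))
  -- the remainder rows at both spacings, `θ₀ = κ₀ ∕ L^m`
  have hΘ := remainderConst_le d (a := a) hC.le hδ₀ hC₁.le hδ₁ hcrK hwR hwm
  have hK : ∀ k : Fin (d + 1) → ZMod (2 * L),
      HasMaj (BlockNorm.ofBlocks (unitTorusGeo L kk M) (fun b : Tor (fine (L ^ kk) M) × Fin (d + 1) => blockOf (L ^ kk) M b.1))
        (BlockNorm.ofBlocks (unitTorusGeo L kk M) (fun b : Tor (fine (L ^ kk) M) × Fin (d + 1) => blockOf (L ^ kk) M b.1))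
        (commOp (deltaOp M (L ^ kk) a) (knitH d L m kk (L ^ kk) hL k) ∘ₗ knitG d L m kk (L ^ kk) hL a k)
        (fun y y' => ind ((cubeBlocks M (coverCorner M (L ^ m) L (coverMargin L m) k) (L * L ^ m) : Finset (Tor M)) : Set (Tor M)) y' *
          (κ₀ / ((L ^ m : ℕ) : ℝ) * Real.exp (-(δ * tdistT M y y')))) := fun k =>
    hasMaj_rate_le (hind1 k) (by positivity) hδK2
      ((hasMaj_commOp_deltaOp_comp_neumannCubeG (L := L) (kk := kk) hM hw hfit hC hδ₀ hC₁.le hδ₁ hG hD hNL k).mono fun y y' =>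
        mul_le_mul_of_nonneg_left (mul_le_mul_of_nonneg_right hΘ (Real.exp_nonneg _)) (ind_nonneg _ _))
  have hK' : ∀ k : Fin (d + 1) → ZMod (2 * L),
      HasMaj (BlockNorm.ofBlocks (unitTorusGeo L kk M) ((fun b : Tor (fine (L ^ kk) M) × Fin (d + 1) => blockOf (L ^ kk) M b.1) ∘ kingPrV L kk r M))
        (BlockNorm.ofBlocks (unitTorusGeo L kk M) ((fun b : Tor (fine (L ^ kk) M) × Fin (d + 1) => blockOf (L ^ kk) M b.1) ∘ kingPrV L kk r M))
        (commOp (deltaOp M (L ^ r * L ^ kk) a) (knitH d L m kk (L ^ r * L ^ kk) hL k) ∘ₗ knitG d L m kk (L ^ r * L ^ kk) hL a k)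
        (fun y y' => ind ((cubeBlocks M (coverCorner M (L ^ m) L (coverMargin L m) k) (L * L ^ m) : Finset (Tor M)) : Set (Tor M)) y' *
          (κ₀ / ((L ^ m : ℕ) : ℝ) * Real.exp (-(δ * tdistT M y y')))) := fun k => by
    rw [← hblk]
    exact hasMaj_rate_le (hind1 k) (by positivity) hδK2
      ((hasMaj_commOp_deltaOp_comp_neumannCubeG (L := L) (kk := kk) hM hw hfit hC hδ₀ hC₁.le hδ₁ hG' hD' hNL' k).mono fun y y' =>
        mul_le_mul_of_nonneg_left (mul_le_mul_of_nonneg_right hΘ (Real.exp_nonneg _)) (ind_nonneg _ _))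
  -- the defects: cut (N-IIc) and remainder (FILE 77)
  have hDGc : ∀ k : Fin (d + 1) → ZMod (2 * L),
      HasMaj (BlockNorm.ofBlocks (unitTorusGeo L kk M) (fun b : Tor (fine (L ^ kk) M) × Fin (d + 1) => blockOf (L ^ kk) M b.1))
        (BlockNorm.ofBlocks (unitTorusGeo L kk M) ((fun b : Tor (fine (L ^ kk) M) × Fin (d + 1) => blockOf (L ^ kk) M b.1) ∘ kingPrV L kk r M))
        (idef (pull (kingPrV L kk r M)) (pull (kingPrV L kk r M))
          (mulOp (chiCube M (L ^ r * L ^ kk) (coverCorner M (L ^ m) L (coverMargin L m) k) (L * L ^ m)) ∘ₗ knitG d L m kk (L ^ r * L ^ kk) hL a k)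
          (mulOp (chiCube M (L ^ kk) (coverCorner M (L ^ m) L (coverMargin L m) k) (L * L ^ m)) ∘ₗ knitG d L m kk (L ^ kk) hL a k))
        (fun y y' => ind ((cubeBlocks M (coverCorner M (L ^ m) L (coverMargin L m) k) (L * L ^ m) : Finset (Tor M)) : Set (Tor M)) y *
          ind ((cubeBlocks M (coverCorner M (L ^ m) L (coverMargin L m) k) (L * L ^ m) : Finset (Tor M)) : Set (Tor M)) y' * (mc * ε * Real.exp (-(δ * tdistT M y y')))) := fun k => by
    have h := HC (m + 1) kk r hk hL (coverCorner M (L ^ m) L (coverMargin L m) k)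
    rw [hSe, hexp16] at h
    have h2 := hasMaj_rate_le (hind k) (by positivity : 0 ≤ mc * ε) hδc' h
    rw [hblk] at h2
    exact h2
  have hDK : ∀ k : Fin (d + 1) → ZMod (2 * L),
      HasMaj (BlockNorm.ofBlocks (unitTorusGeo L kk M) (fun b : Tor (fine (L ^ kk) M) × Fin (d + 1) => blockOf (L ^ kk) M b.1))
        (BlockNorm.ofBlocks (unitTorusGeo L kk M) ((fun b : Tor (fine (L ^ kk) M) × Fin (d + 1) => blockOf (L ^ kk) M b.1) ∘ kingPrV L kk r M))
        (idef (pull (kingPrV L kk r M)) (pull (kingPrV L kk r M))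
          (commOp (deltaOp M (L ^ r * L ^ kk) a) (knitH d L m kk (L ^ r * L ^ kk) hL k) ∘ₗ knitG d L m kk (L ^ r * L ^ kk) hL a k)
          (commOp (deltaOp M (L ^ kk) a) (knitH d L m kk (L ^ kk) hL k) ∘ₗ knitG d L m kk (L ^ kk) hL a k))
        (fun y y' => ind ((cubeBlocks M (coverCorner M (L ^ m) L (coverMargin L m) k) (L * L ^ m) : Finset (Tor M)) : Set (Tor M)) y' *
          (Cr * ε * Real.exp (-(δ * tdistT M y y')))) := fun k => by
    have h := hasMaj_rate_le (hind1 k) (by positivity : 0 ≤ Cr * ε) hδ7' (H7 m kk r hk hn4 k)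
    rw [hblk] at h
    exact h
  -- the partition: cuts, bounds, fit, overlap
  have hcut : ∀ k : Fin (d + 1) → ZMod (2 * L), mulOp (knitH d L m kk (L ^ kk) hL k) ∘ₗ mulOp (chiCube M (L ^ kk) (coverCorner M (L ^ m) L (coverMargin L m) k) (L * L ^ m)) =
      mulOp (knitH d L m kk (L ^ kk) hL k) := fun k =>
    hcube_cut (2 * L) (coverXi M (L ^ kk) (L ^ m)) (bshiftEquiv M (L ^ kk)) 0 (chiCube_coverCorner_eq_one_side (M := M) (n := L ^ kk) (m₀ := coverMargin L m) hM hw hfit1 hS 0 k)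
  have hcut' : ∀ k : Fin (d + 1) → ZMod (2 * L), mulOp (knitH d L m kk (L ^ r * L ^ kk) hL k) ∘ₗ mulOp (chiCube M (L ^ r * L ^ kk) (coverCorner M (L ^ m) L (coverMargin L m) k) (L * L ^ m)) =
      mulOp (knitH d L m kk (L ^ r * L ^ kk) hL k) := fun k =>
    hcube_cut (2 * L) (coverXi M (L ^ r * L ^ kk) (L ^ m)) (bshiftEquiv M (L ^ r * L ^ kk)) 0
      (chiCube_coverCorner_eq_one_side (M := M) (n := L ^ r * L ^ kk) (m₀ := coverMargin L m) hM hw hfit1 hS 0 k)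
  have hh : ∀ (k : Fin (d + 1) → ZMod (2 * L)) x, |knitH d L m kk (L ^ kk) hL k x| ≤ 1 := fun k x => abs_coverH_le_one k x
  have hh' : ∀ (k : Fin (d + 1) → ZMod (2 * L)) x', |knitH d L m kk (L ^ r * L ^ kk) hL k x'| ≤ 1 := fun k x' => abs_coverH_le_one k x'
  have hfitH : ∀ (k : Fin (d + 1) → ZMod (2 * L)) x', |knitH d L m kk (L ^ r * L ^ kk) hL k x' - knitH d L m kk (L ^ kk) hL k (kingPrV L kk r M x')| ≤
      π * (d + 1) / (((L ^ kk : ℕ) : ℝ) * ((L ^ m : ℕ) : ℝ)) := fun k x' => abs_coverH_fine_sub_le (L := L) (kk := kk) (r := r) hM hw k x'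
  have hN := fun y => sum_ind_cubeBlocks_le (M := M) (w := L ^ m) (q := L) (m₀ := coverMargin L m) L kk y

  -- the five rows
  have e0 : parametrix (X := Tor (fine (L ^ kk) M) × Fin (d + 1)) (knitH d L m kk (L ^ kk) hL)
        (fun k : Fin (d + 1) → ZMod (2 * L) => mulOp (chiCube M (L ^ kk) (coverCorner M (L ^ m) L (coverMargin L m) k) (L * L ^ m)) ∘ₗ knitG d L m kk (L ^ kk) hL a k) =
      parametrix (X := Tor (fine (L ^ kk) M) × Fin (d + 1)) (knitH d L m kk (L ^ kk) hL) (knitG d L m kk (L ^ kk) hL a) :=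
    parametrix_cut (G := knitG d L m kk (L ^ kk) hL a) hcut
  have e0' : parametrix (X := Tor (fine (L ^ r * L ^ kk) M) × Fin (d + 1)) (knitH d L m kk (L ^ r * L ^ kk) hL)
        (fun k : Fin (d + 1) → ZMod (2 * L) => mulOp (chiCube M (L ^ r * L ^ kk) (coverCorner M (L ^ m) L (coverMargin L m) k) (L * L ^ m)) ∘ₗ knitG d L m kk (L ^ r * L ^ kk) hL a k) =
      parametrix (X := Tor (fine (L ^ r * L ^ kk) M) × Fin (d + 1)) (knitH d L m kk (L ^ r * L ^ kk) hL) (knitG d L m kk (L ^ r * L ^ kk) hL a) :=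
    parametrix_cut (G := knitG d L m kk (L ^ r * L ^ kk) hL a) hcut'
  have hP' := hasMaj_parametrix (g := unitTorusGeo L kk M) ((fun b : Tor (fine (L ^ kk) M) × Fin (d + 1) => blockOf (L ^ kk) M b.1) ∘ kingPrV L kk r M)
    (fun k => ((cubeBlocks M (coverCorner M (L ^ m) L (coverMargin L m) k) (L * L ^ m) : Finset (Tor M)) : Set (Tor M))) hβ hh' hN hGc'
  rw [e0'] at hP'
  have hIP := hasMaj_idef_parametrix (g := unitTorusGeo L kk M) (fun b : Tor (fine (L ^ kk) M) × Fin (d + 1) => blockOf (L ^ kk) M b.1) (kingPrV L kk r M)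
    (fun k => ((cubeBlocks M (coverCorner M (L ^ m) L (coverMargin L m) k) (L * L ^ m) : Finset (Tor M)) : Set (Tor M))) hβ (by positivity : 0 ≤ mc * ε)
    (by positivity : (0 : ℝ) ≤ π * (d + 1) / (((L ^ kk : ℕ) : ℝ) * ((L ^ m : ℕ) : ℝ))) hh hh' hfitH hN hGc hGc' hDGc
  rw [e0, e0'] at hIP
  have hR := hasMaj_remainder_in (g := unitTorusGeo L kk M) (fun b : Tor (fine (L ^ kk) M) × Fin (d + 1) => blockOf (L ^ kk) M b.1)
    (fun k => ((cubeBlocks M (coverCorner M (L ^ m) L (coverMargin L m) k) (L * L ^ m) : Finset (Tor M)) : Set (Tor M))) (Δ := deltaOp M (L ^ kk) a)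
    (h := knitH d L m kk (L ^ kk) hL) (G := knitG d L m kk (L ^ kk) hL a) (by positivity : 0 ≤ κ₀ / ((L ^ m : ℕ) : ℝ)) hh hN hK
  have hR' := hasMaj_remainder_in (g := unitTorusGeo L kk M) ((fun b : Tor (fine (L ^ kk) M) × Fin (d + 1) => blockOf (L ^ kk) M b.1) ∘ kingPrV L kk r M)
    (fun k => ((cubeBlocks M (coverCorner M (L ^ m) L (coverMargin L m) k) (L * L ^ m) : Finset (Tor M)) : Set (Tor M))) (Δ := deltaOp M (L ^ r * L ^ kk) a)
    (h := knitH d L m kk (L ^ r * L ^ kk) hL) (G := knitG d L m kk (L ^ r * L ^ kk) hL a) (by positivity : 0 ≤ κ₀ / ((L ^ m : ℕ) : ℝ)) hh' hN hK'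
  have hIR := hasMaj_idef_remainder_in (g := unitTorusGeo L kk M) (fun b : Tor (fine (L ^ kk) M) × Fin (d + 1) => blockOf (L ^ kk) M b.1) (kingPrV L kk r M)
    (fun k => ((cubeBlocks M (coverCorner M (L ^ m) L (coverMargin L m) k) (L * L ^ m) : Finset (Tor M)) : Set (Tor M))) (Δ := deltaOp M (L ^ kk) a) (Δ' := deltaOp M (L ^ r * L ^ kk) a)
    (h := knitH d L m kk (L ^ kk) hL) (h' := knitH d L m kk (L ^ r * L ^ kk) hL) (G := knitG d L m kk (L ^ kk) hL a) (G' := knitG d L m kk (L ^ r * L ^ kk) hL a)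
    (by positivity : 0 ≤ κ₀ / ((L ^ m : ℕ) : ℝ)) (by positivity : 0 ≤ Cr * ε) (by positivity : (0 : ℝ) ≤ π * (d + 1) / (((L ^ kk : ℕ) : ℝ) * ((L ^ m : ℕ) : ℝ))) hh hfitH hN hK' hDK
  rw [← hblk] at hP' hIP hR' hIR
  rw [← hNov_def] at hP' hIP hR hR' hIR
  have ho : π * (d + 1) / (((L ^ kk : ℕ) : ℝ) * ((L ^ m : ℕ) : ℝ)) ≤ π * (d + 1) * ε := by
    rw [div_eq_mul_inv]; exact mul_le_mul_of_nonneg_left hnwε (by positivity)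
  have hθκ : κ₀ / ((L ^ m : ℕ) : ℝ) ≤ κ₀ := div_le_self hκ₀ hwR
  have hNov0 : (0 : ℝ) ≤ Nov := by rw [hNov_def]; positivity
  have h1 : Nov * β ≤ Nov * β + 1 := le_add_of_nonneg_right zero_le_one
  refine ⟨hP'.mono fun y y' => mul_le_mul_of_nonneg_right h1 (Real.exp_nonneg _),
    hR.mono fun y y' => ?_, hR'.mono fun y y' => ?_,
    hIP.mono fun y y' => mul_le_mul_of_nonneg_right ?_ (Real.exp_nonneg _), hIR.mono fun y y' => mul_le_mul_of_nonneg_right ?_ (Real.exp_nonneg _)⟩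
  · rw [← mul_div_assoc]; exact le_rfl
  · rw [← mul_div_assoc]; exact le_rfl
  · have t : 2 * β * (π * (d + 1) / (((L ^ kk : ℕ) : ℝ) * ((L ^ m : ℕ) : ℝ))) ≤ 2 * β * (π * (d + 1) * ε) := mul_le_mul_of_nonneg_left ho (by positivity)
    calc Nov * (2 * β * (π * (d + 1) / (((L ^ kk : ℕ) : ℝ) * ((L ^ m : ℕ) : ℝ))) + mc * ε) ≤ Nov * (2 * β * (π * (d + 1) * ε) + mc * ε) :=
          mul_le_mul_of_nonneg_left (add_le_add t le_rfl) hNov0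
      _ = Nov * (2 * β * (π * (d + 1)) + mc) * ε := by ring
      _ ≤ (Nov * (2 * β * (π * (d + 1)) + mc) + 1) * ε := mul_le_mul_of_nonneg_right (le_add_of_nonneg_right zero_le_one) hε0
  · have t : κ₀ / ((L ^ m : ℕ) : ℝ) * (π * (d + 1) / (((L ^ kk : ℕ) : ℝ) * ((L ^ m : ℕ) : ℝ))) ≤ κ₀ * (π * (d + 1) * ε) :=
      mul_le_mul hθκ ho (by positivity) hκ₀
    calc Nov * (κ₀ / ((L ^ m : ℕ) : ℝ) * (π * (d + 1) / (((L ^ kk : ℕ) : ℝ) * ((L ^ m : ℕ) : ℝ))) + Cr * ε) ≤ Nov * (κ₀ * (π * (d + 1) * ε) + Cr * ε) :=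
          mul_le_mul_of_nonneg_left (add_le_add t le_rfl) hNov0
      _ = Nov * (κ₀ * (π * (d + 1)) + Cr) * ε := by ring
      _ ≤ (Nov * (κ₀ * (π * (d + 1)) + Cr) + 1) * ε := mul_le_mul_of_nonneg_right (le_add_of_nonneg_right zero_le_one) hε0

end Rows

end Summit.QuantumFields.YangMills.BalabanUVNodes.N15.Gluing

end
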